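import Summits.HodgeConjecture.CorCM.MultiFieldWeilForeignCurves
import HarnessLib

/-!
# MULTI-FIELD WEIL ENGINE — ANY TWO SIMPLE CM ABELIAN VARIETIES OF DIMENSION `≤ 3` AND A FOREIGN CM ELLIPTIC CURVE: the Hodge conjecture for every
# `A₀^a × A₁^b × E′^c`, given ONLY Markman's fourfold theorem

Cell `pub-hodgecm2` (COR-CM), seat b30 gen 33 (2026-08-24); count-neutral own lane MULTI-FIELD WEIL ENGINE (stem `MultiFieldWeil*`), sequel of
`CorCM/MultiFieldWeilForeignCurves.lean` (§2 `hodgeConjectureFor_prod_of_foreignCurves`: foreign CM elliptic curves join any family for free) over gen 31's roof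
`CorCM/MultiFieldWeilAnyTwoSimpleDimLeThree.lean` (G7: ANY two simple CM abelian varieties of dimension `≤ 3`).  Theorems only; no definition, no named fact, no
`sorry`.  HONEST FRAMING: conditional on the displayed Markman fourfold binder only; `HC_CM` is NOT proved and not asserted.

THE STATEMENT (**`hodgeConjectureFor_biproduct_comp_vec_of_any_two_simple_dim_le_three_foreignCurve_of_markman`**).  `A₀ ⊨ (K₀; Φ₀)`, `A₁ ⊨ (K₁; Φ₁)` SIMPLE CM
abelian varieties of dimension `≤ 3` (CM elliptic curves, simple CM surfaces, simple CM threefolds), `E′ ⊨ (k′; Ψ′)` a CM elliptic curve whose field `k′` embeds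
NEITHER in `K₀` NOR in `K₁` (for a curve `A_i`: `k′ ≄ K_i`).  Then for every `κ : Fin N → Fin 3` the Hodge conjecture holds for `⨁_j ![A₀, A₁, E′] (κ j)` — every
`A₀^a × A₁^b × E′^c` — GIVEN ONLY `Markman2025_weilClasses_algebraic_abelianFourfold` (blocks `{A₀, A₁}` = G7 and `{E′}` = powers of a CM curve, glued by
`hodgeConjectureFor_prod_of_foreignCurves`; Markman is used only inside G7, i.e. for `(E, T)` with `k ↪ K_T` and `(T₀, T₁)` sharing an imaginary quadratic field).
This extends gen 31's G9 (`CorCM/MultiFieldWeilTwoThreefoldsForeignCurve.lean`: `k′` foreign to the GALOIS CLOSURES, a partial conjugation) to `k′` foreign to the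
FIELDS — e.g. `k′` inside the Galois closure of `K_T` but not in `K_T`.

WHAT IS NOT COVERED (honest).  `k′ ↪ K₀` with `A₀` a surface or threefold and `A₁` a threefold not through `k′` (e.g. `K₁ = k₁ · F₀`, the other CM sextic field in
the Galois closure of `K₀ = k′ · F₀`): block additivity `{E′, A₀} ∣ {A₁}` holds (rank check `7 + 2 = 4 + 4 + 1`) but the two sextic slots SHARE a constituent, so the
slot criterion of this file does not apply; the case `A₀ = E`, `A₁ = T` is complete (`hodgeConjectureFor_biproduct_comp_vec_of_two_cmCurves_simpleThreefold_of_markman`).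

[cite: MoonenZarhin1999LowDim, Thm. (0.1), (0.2), §3 (3.1), Cor. (3.9), §5 (5.2)] [cite: Markman2025SurveySecant, Thm. 1.2] [cite: Gordon1999HodgeAVSurvey, §3 Theorem (proof), 7.5–7.7]
[cite: MumfordAV1970, §19 Thm. 1 and p. 169]

## References
* [MoonenZarhin1999LowDim] B. Moonen, Yu. Zarhin, Math. Ann. 315 (1999) 711–733.  [Markman2025SurveySecant] E. Markman, arXiv:2509.23403, Thm. 1.2.
  [Gordon1999HodgeAVSurvey] B. B. Gordon, *A survey of the Hodge conjecture for abelian varieties*, §3, 7.5–7.7.  [MumfordAV1970] D. Mumford, *Abelian Varieties*, §19.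
-/

noncomputable section

open CategoryTheory CategoryTheory.Limits NumberField IntermediateField

namespace Summit.HodgeConjecture.CorCM.MultiFieldWeil

open Literature.AlgebraicGeometry Literature.AlgebraicGeometry.Motives Literature.AlgebraicGeometry.HodgeTheory
open Literature.AlgebraicGeometry.ComplexMultiplication (IsCMTypeRealisation)
open Literature.AlgebraicTopology.SingularHomology
open Literature.NumberTheory.ComplexMultiplication

open scoped Classical

section PairAndCurve

variable {K₀ K₁ k' : Type} [Field K₀] [NumberField K₀] [IsCMField K₀] [Field K₁] [NumberField K₁] [IsCMField K₁] [Field k'] [NumberField k'] [IsCMField k']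
  {N : ℕ} {A₀ A₁ E' : AbelianVariety ℂ} {Φ₀ : CMType K₀} {Φ₁ : CMType K₁} {Ψ' : CMType k'}
  {ι₀ : 𝓞 K₀ →+* End A₀} {θ₀ : K₀ →+* Module.End ℂ (complexBetti A₀.X 1)}
  {ι₁ : 𝓞 K₁ →+* End A₁} {θ₁ : K₁ →+* Module.End ℂ (complexBetti A₁.X 1)}
  {ιE' : 𝓞 k' →+* End E'} {θE' : k' →+* Module.End ℂ (complexBetti E'.X 1)}

/-- **ANY TWO SIMPLE CM ABELIAN VARIETIES OF DIMENSION `≤ 3` AND A FOREIGN CM ELLIPTIC CURVE — given ONLY Markman's fourfold theorem.**  `A₀ ⊨ (K₀; Φ₀)`,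
`A₁ ⊨ (K₁; Φ₁)` SIMPLE, of CM type, `dim ≤ 3`; `E′ ⊨ (k′; Ψ′)` a CM elliptic curve with `k′` embedding neither in `K₀` nor in `K₁`.  Then for every `κ : Fin N → Fin 3`
— every `A₀^a × A₁^b × E′^c` — the Hodge conjecture holds for `⨁_j ![A₀, A₁, E′] (κ j)`, GIVEN ONLY `Markman2025_weilClasses_algebraic_abelianFourfold`
(`hodgeConjectureFor_prod_of_foreignCurves` over G7 and the powers of `E′`).  `HC_CM` is NOT asserted. [cite: MoonenZarhin1999LowDim, Thm. (0.1), (0.2), §3 (3.1), Cor. (3.9)]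
[cite: Markman2025SurveySecant, Thm. 1.2] [cite: Gordon1999HodgeAVSurvey, §3 Theorem (proof), 7.5–7.7] -/
theorem hodgeConjectureFor_biproduct_comp_vec_of_any_two_simple_dim_le_three_foreignCurve_of_markman (hW4 : Markman2025_weilClasses_algebraic_abelianFourfold)
    (hA₀ : IsCMTypeRealisation Φ₀ A₀ ι₀ θ₀) (hA₁ : IsCMTypeRealisation Φ₁ A₁ ι₁ θ₁) (hS₀ : A₀.IsSimple) (hS₁ : A₁.IsSimple) (h3₀ : A₀.dim ≤ 3) (h3₁ : A₁.dim ≤ 3)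
    (h2' : Module.finrank ℚ k' = 2) (hE' : IsCMTypeRealisation Ψ' E' ιE' θE') (h₀ : IsEmpty (k' →+* K₀)) (h₁ : IsEmpty (k' →+* K₁)) (κ : Fin N → Fin 3) :
    HodgeConjectureFor (⨁ fun j => (![A₀, A₁, E'] : Fin 3 → AbelianVariety ℂ) (κ j)).dim (⨁ fun j => (![A₀, A₁, E'] : Fin 3 → AbelianVariety ℂ) (κ j)).X := by
  -- the family of fields `(K₀, K₁, k')` with its instances (all identifications below are definitional)
  let Kf : Fin 3 → Type := Fin.cons K₀ (Fin.cons K₁ (Fin.cons k' finZeroElim))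
  letI instF : ∀ j, Field (Kf j) := Fin.cons ‹Field K₀› (Fin.cons ‹Field K₁› (Fin.cons ‹Field k'› finZeroElim))
  letI instN : ∀ j, NumberField (Kf j) := Fin.cons ‹NumberField K₀› (Fin.cons ‹NumberField K₁› (Fin.cons ‹NumberField k'› finZeroElim))
  haveI instC : ∀ j, IsCMField (Kf j) := Fin.cons ‹IsCMField K₀› (Fin.cons ‹IsCMField K₁› (Fin.cons ‹IsCMField k'› finZeroElim))
  let Φf : ∀ j : Fin 3, CMType (Kf j) := Fin.cons Φ₀ (Fin.cons Φ₁ (Fin.cons Ψ' finZeroElim))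
  let ιf : ∀ j : Fin 3, 𝓞 (Kf j) →+* End ((![A₀, A₁, E'] : Fin 3 → AbelianVariety ℂ) j) := Fin.cons ι₀ (Fin.cons ι₁ (Fin.cons ιE' finZeroElim))
  let θf : ∀ j : Fin 3, Kf j →+* Module.End ℂ (complexBetti ((![A₀, A₁, E'] : Fin 3 → AbelianVariety ℂ) j).X 1) :=
    Fin.cons θ₀ (Fin.cons θ₁ (Fin.cons θE' finZeroElim))
  have hA : ∀ j, IsCMTypeRealisation (Φf j) ((![A₀, A₁, E'] : Fin 3 → AbelianVariety ℂ) j) (ιf j) (θf j) :=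
    Fin.cons hA₀ (Fin.cons hA₁ (Fin.cons hE' finZeroElim))
  refine hodgeConjectureFor_prod_of_foreignCurves (K := Kf) (A := (![A₀, A₁, E'] : Fin 3 → AbelianVariety ℂ)) hA (fun i => i = 2) ?_ ?_ ⟨2, rfl⟩
    ⟨0, by decide⟩ ?_ ?_ κ
  · -- the marked slot is `k'`
    intro a ha
    subst ha
    exact h2'
  · -- `k'` embeds neither in `K₀` nor in `K₁`
    intro a j ha hj
    subst ha
    fin_cases j
    · exact h₀
    · exact h₁
    · exact absurd rfl hj
  · -- products of copies of `E'`
    intro M ρ hρ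
    have hfun : (fun l => (![A₀, A₁, E'] : Fin 3 → AbelianVariety ℂ) (ρ l)) = fun _ => E' := funext fun l => by rw [hρ l]; rfl
    rw [hfun]
    exact hodgeConjectureFor_biproduct_const_of_cmCurve h2' hE' M
  · -- products of copies of `A₀` and `A₁`: gen 31's G7
    intro M ρ hρ
    have key : ∀ i : Fin 3, i ≠ 2 → (![A₀, A₁, E'] : Fin 3 → AbelianVariety ℂ) i = (![A₀, A₁] : Fin 2 → AbelianVariety ℂ) (if i = 0 then 0 else 1) := by
      intro i hi
      fin_cases i
      · rfl
      · rfl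
      · exact absurd rfl hi
    have hfun : (fun l => (![A₀, A₁, E'] : Fin 3 → AbelianVariety ℂ) (ρ l)) =
        fun l => (![A₀, A₁] : Fin 2 → AbelianVariety ℂ) (if ρ l = 0 then 0 else 1) := funext fun l => key (ρ l) (hρ l)
    rw [hfun]
    exact hodgeConjectureFor_biproduct_comp_vec_of_any_two_simple_dim_le_three_of_markman hW4 hA₀ hA₁ hS₀ hS₁ h3₀ h3₁ fun l => if ρ l = 0 then 0 else 1

/-- **`A₀ × A₁ × E′` itself**, for any two simple CM abelian varieties of dimension `≤ 3` and a foreign CM elliptic curve, given only Markman's fourfold theorem.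
[cite: MoonenZarhin1999LowDim, Thm. (0.2)] [cite: Markman2025SurveySecant, Thm. 1.2] -/
theorem hodgeConjectureFor_biproduct_vec_of_any_two_simple_dim_le_three_foreignCurve_of_markman (hW4 : Markman2025_weilClasses_algebraic_abelianFourfold)
    (hA₀ : IsCMTypeRealisation Φ₀ A₀ ι₀ θ₀) (hA₁ : IsCMTypeRealisation Φ₁ A₁ ι₁ θ₁) (hS₀ : A₀.IsSimple) (hS₁ : A₁.IsSimple) (h3₀ : A₀.dim ≤ 3) (h3₁ : A₁.dim ≤ 3)
    (h2' : Module.finrank ℚ k' = 2) (hE' : IsCMTypeRealisation Ψ' E' ιE' θE') (h₀ : IsEmpty (k' →+* K₀)) (h₁ : IsEmpty (k' →+* K₁)) :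
    HodgeConjectureFor (⨁ (![A₀, A₁, E'] : Fin 3 → AbelianVariety ℂ)).dim (⨁ (![A₀, A₁, E'] : Fin 3 → AbelianVariety ℂ)).X :=
  hodgeConjectureFor_biproduct_comp_vec_of_any_two_simple_dim_le_three_foreignCurve_of_markman hW4 hA₀ hA₁ hS₀ hS₁ h3₀ h3₁ h2' hE' h₀ h₁ (id : Fin 3 → Fin 3)

/-- **Dominated form**: everything dominated by some `A₀^a × A₁^b × E′^c` (everything isogenous to such a product, every abelian subvariety or quotient of one), given
only Markman's fourfold theorem. [cite: MoonenZarhin1999LowDim, Thm. (0.2)] [cite: Markman2025SurveySecant, Thm. 1.2] [cite: MumfordAV1970, §19 Thm. 1 and p. 169] -/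
theorem hodgeConjectureFor_of_avDominatedBy_comp_vec_of_any_two_simple_dim_le_three_foreignCurve_of_markman
    (hW4 : Markman2025_weilClasses_algebraic_abelianFourfold) (hA₀ : IsCMTypeRealisation Φ₀ A₀ ι₀ θ₀) (hA₁ : IsCMTypeRealisation Φ₁ A₁ ι₁ θ₁)
    (hS₀ : A₀.IsSimple) (hS₁ : A₁.IsSimple) (h3₀ : A₀.dim ≤ 3) (h3₁ : A₁.dim ≤ 3) (h2' : Module.finrank ℚ k' = 2) (hE' : IsCMTypeRealisation Ψ' E' ιE' θE')
    (h₀ : IsEmpty (k' →+* K₀)) (h₁ : IsEmpty (k' →+* K₁)) (κ : Fin N → Fin 3) {X : AbelianVariety ℂ}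
    (hX : Domination.AVDominatedBy X (⨁ fun j => (![A₀, A₁, E'] : Fin 3 → AbelianVariety ℂ) (κ j))) : HodgeConjectureFor X.dim X.X :=
  Domination.hodgeConjectureFor_of_avDominatedBy
    (hodgeConjectureFor_biproduct_comp_vec_of_any_two_simple_dim_le_three_foreignCurve_of_markman hW4 hA₀ hA₁ hS₀ hS₁ h3₀ h3₁ h2' hE' h₀ h₁ κ) hX

/-- **Every abelian variety ISOGENOUS TO A PRODUCT OF COPIES of `A₀, A₁, E′`** (any finite index type), given only Markman's fourfold theorem.
[cite: MoonenZarhin1999LowDim, Thm. (0.2)] [cite: Markman2025SurveySecant, Thm. 1.2] [cite: MumfordAV1970, §19] -/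
theorem hodgeConjectureFor_of_isIsogenous_biproduct_comp_of_any_two_simple_dim_le_three_foreignCurve_of_markman
    (hW4 : Markman2025_weilClasses_algebraic_abelianFourfold) (hA₀ : IsCMTypeRealisation Φ₀ A₀ ι₀ θ₀) (hA₁ : IsCMTypeRealisation Φ₁ A₁ ι₁ θ₁)
    (hS₀ : A₀.IsSimple) (hS₁ : A₁.IsSimple) (h3₀ : A₀.dim ≤ 3) (h3₁ : A₁.dim ≤ 3) (h2' : Module.finrank ℚ k' = 2) (hE' : IsCMTypeRealisation Ψ' E' ιE' θE')
    (h₀ : IsEmpty (k' →+* K₀)) (h₁ : IsEmpty (k' →+* K₁)) {J : Type} [Fintype J] (cls : J → Fin 3) {X : AbelianVariety ℂ}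
    (hX : AbelianVariety.IsIsogenous X (⨁ fun j => (![A₀, A₁, E'] : Fin 3 → AbelianVariety ℂ) (cls j))) : HodgeConjectureFor X.dim X.X := by
  classical
  let ε : Fin (Fintype.card J) ≃ J := (Fintype.equivFin J).symm
  have e : (⨁ fun j => (![A₀, A₁, E'] : Fin 3 → AbelianVariety ℂ) (cls j)) ≅ ⨁ fun l => (![A₀, A₁, E'] : Fin 3 → AbelianVariety ℂ) (cls (ε l)) :=
    (biproduct.reindex ε fun j => (![A₀, A₁, E'] : Fin 3 → AbelianVariety ℂ) (cls j)).symm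
  exact hodgeConjectureFor_of_avDominatedBy_comp_vec_of_any_two_simple_dim_le_three_foreignCurve_of_markman hW4 hA₀ hA₁ hS₀ hS₁ h3₀ h3₁ h2' hE' h₀ h₁
    (fun l => cls (ε l)) (Domination.AVDominatedBy.of_isIsogenous hX (Domination.AVDominatedBy.of_iso e (Domination.AVDominatedBy.refl _)))

end PairAndCurve

end Summit.HodgeConjecture.CorCM.MultiFieldWeil

end
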